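import Literature.Analysis.Complex.RectangleCauchyFormula
import Literature.Analysis.Complex.Runge
import Mathlib.Analysis.Complex.Convex
import Mathlib.Analysis.Calculus.Deriv.Polynomial
import HarnessLib

/-!
# Runge's approximation theorem with parameters on a rectangle (Grauert–Remmert, Kap. III §2)

Let `R = [a, b] × [c, d] ⊂ ℂ` be a compact rectangle, `K'` a compact set of parameters (in a normed
space `P`), and `f(z, p)` holomorphic (jointly, with values in a complex Banach space `F`) on an open
set containing `Q × K'`, `Q ⊃ R` a bigger closed rectangle. Then for every `δ > 0` there is an
approximant of the form

  `f̂(z, p) = ∑_ν t_ν(z) • f(ζ_ν, p)`,   `ζ_ν ∈ ∂Q`, `t_ν ∈ ℂ[z]`,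

— a polynomial in `z` whose coefficients are values of `f`, hence holomorphic in `p` near `K'` —
with `‖f − f̂‖ ≤ δ` on `R × K'` (`runge_rectangle_param`, Grauert–Remmert, *Theorie der Steinschen
Räume*, Kap. III §2 Satz 1, p. 91). In particular there is `g` holomorphic on `ℂ × V`, `V ⊇ K'` open,
with `‖f − g‖ ≤ δ` on `R × K'` (`exists_holomorphic_approx_rectangle_param`).

## The argument (GR, loc. cit.)

Cauchy's integral formula over `∂Q` (here for Banach-space-valued maps,
`integral_boundary_rect_inv_sub_smul_eq`, from Cauchy–Goursat applied to `dslope f ρ`), a Riemann sum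
of the four side integrals, uniform in `(z, p) ∈ R × K'` by uniform continuity of the integrand on
the compact set `∂Q × R × K'` (`exists_riemann_sum_approx`), and Runge approximation on `R` of the
finitely many Cauchy kernels `z ↦ (ζ_ν − z)⁻¹`, `ζ_ν ∈ ∂Q` (the tree's one-variable Runge theorem
`Complex.exists_polynomial_norm_sub_lt`; `ℂ \ R` is connected, `isPreconnected_compl_reProdIm`).

## References

* H. Grauert, R. Remmert, *Theorie der Steinschen Räume*, Grundlehren 227, Springer (1977),
  Kap. III §2.1 Satz 1 (Runge) and its Korollar (Approximationssatz für Quader) [GrauertRemmert1977].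
-/

noncomputable section

open Complex Set MeasureTheory Filter Topology intervalIntegral Metric

namespace Literature.Analysis.Complex

/-! ### Cauchy's integral formula on a rectangle, Banach-space-valued -/

section Cauchy

variable {F : Type*} [NormedAddCommGroup F] [NormedSpace ℂ F] [CompleteSpace F]

/-- **Cauchy's integral formula for a rectangle, vector-valued.** For `f : ℂ → F` complex
differentiable on the closed rectangle `[a,b] × [c,d]` and `ρ` an interior point, in Mathlib's
four-term boundary convention (bottom − top + i·right − i·left),
`∮_{∂R} (z - ρ)⁻¹ • f(z) dz = 2πi • f(ρ)`. (Cauchy–Goursat for `dslope f ρ` plus the winding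
integral `integral_boundary_rect_inv_sub`.) [folklore] -/
theorem integral_boundary_rect_inv_sub_smul_eq {f : ℂ → F} (ρ : ℂ) {a b c d : ℝ} (ha : a < ρ.re)
    (hb : ρ.re < b) (hc : c < ρ.im) (hd : ρ.im < d)
    (hf : DifferentiableOn ℂ f (Icc a b ×ℂ Icc c d)) :
    (∫ x : ℝ in a..b, ((x : ℂ) + c * I - ρ)⁻¹ • f ((x : ℂ) + c * I)) -
      (∫ x : ℝ in a..b, ((x : ℂ) + d * I - ρ)⁻¹ • f ((x : ℂ) + d * I)) +
      I • (∫ y : ℝ in c..d, ((b : ℂ) + y * I - ρ)⁻¹ • f ((b : ℂ) + y * I)) -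
      I • (∫ y : ℝ in c..d, ((a : ℂ) + y * I - ρ)⁻¹ • f ((a : ℂ) + y * I)) =
      (2 * Real.pi * I) • f ρ := by
  have hab : a ≤ b := (ha.trans hb).le
  have hcd : c ≤ d := (hc.trans hd).le
  have hR : Icc a b ×ℂ Icc c d ∈ 𝓝 ρ := by
    refine mem_of_superset ((isOpen_Ioo.reProdIm isOpen_Ioo).mem_nhds
      (show ρ ∈ Ioo a b ×ℂ Ioo c d from ⟨⟨ha, hb⟩, ⟨hc, hd⟩⟩)) ?_
    exact fun z hz ↦ ⟨Ioo_subset_Icc_self hz.1, Ioo_subset_Icc_self hz.2⟩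
  set g : ℂ → F := dslope f ρ with hg
  have hgd : DifferentiableOn ℂ g (Icc a b ×ℂ Icc c d) := (differentiableOn_dslope hR).mpr hf
  have hCG := Complex.integral_boundary_rect_eq_zero_of_differentiableOn g (a + c * I) (b + d * I)
    (by simpa [uIcc_of_le hab, uIcc_of_le hcd] using hgd)
  simp only [add_re, ofReal_re, mul_re, I_re, mul_zero, ofReal_im, I_im, mul_one, sub_self,
    add_zero, add_im, mul_im, zero_add] at hCG
  have hgpt : ∀ z : ℂ, z ≠ ρ → g z = (z - ρ)⁻¹ • f z - (z - ρ)⁻¹ • f ρ := by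
    intro z hz
    rw [hg, dslope_of_ne _ hz, slope_def_module, smul_sub]
  have hne_h : ∀ (x y : ℝ), y ≠ ρ.im → (x : ℂ) + y * I ≠ ρ := by
    intro x y hy h
    apply hy
    simpa using congrArg Complex.im h
  have hne_v : ∀ (x y : ℝ), x ≠ ρ.re → (x : ℂ) + y * I ≠ ρ := by
    intro x y hx h
    apply hx
    simpa using congrArg Complex.re h
  have hfc : ContinuousOn f (Icc a b ×ℂ Icc c d) := hf.continuousOn
  have hside_h : ∀ y : ℝ, y ∈ Icc c d → y ≠ ρ.im →
      IntervalIntegrable (fun x : ℝ ↦ ((x : ℂ) + y * I - ρ)⁻¹ • f ((x : ℂ) + y * I)) volume a b ∧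
      IntervalIntegrable (fun x : ℝ ↦ ((x : ℂ) + y * I - ρ)⁻¹ • f ρ) volume a b := by
    intro y hy hyne
    have hden : ∀ x : ℝ, (x : ℂ) + y * I - ρ ≠ 0 := fun x ↦ sub_ne_zero.mpr (hne_h x y hyne)
    have h1 : ContinuousOn (fun x : ℝ ↦ f ((x : ℂ) + y * I)) (uIcc a b) := by
      rw [uIcc_of_le hab]
      refine hfc.comp (by fun_prop) ?_
      intro x hx
      exact ⟨by simpa using hx, by simpa using hy⟩
    have h2 : Continuous (fun x : ℝ ↦ ((x : ℂ) + y * I - ρ)⁻¹) :=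
      Continuous.inv₀ (by fun_prop) hden
    exact ⟨(h2.continuousOn.smul h1).intervalIntegrable, (h2.smul continuous_const).intervalIntegrable _ _⟩
  have hside_v : ∀ x : ℝ, x ∈ Icc a b → x ≠ ρ.re →
      IntervalIntegrable (fun y : ℝ ↦ ((x : ℂ) + y * I - ρ)⁻¹ • f ((x : ℂ) + y * I)) volume c d ∧
      IntervalIntegrable (fun y : ℝ ↦ ((x : ℂ) + y * I - ρ)⁻¹ • f ρ) volume c d := by
    intro x hx hxne
    have hden : ∀ y : ℝ, (x : ℂ) + y * I - ρ ≠ 0 := fun y ↦ sub_ne_zero.mpr (hne_v x y hxne)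
    have h1 : ContinuousOn (fun y : ℝ ↦ f ((x : ℂ) + y * I)) (uIcc c d) := by
      rw [uIcc_of_le hcd]
      refine hfc.comp (by fun_prop) ?_
      intro y hy
      exact ⟨by simpa using hx, by simpa using hy⟩
    have h2 : Continuous (fun y : ℝ ↦ ((x : ℂ) + y * I - ρ)⁻¹) :=
      Continuous.inv₀ (by fun_prop) hden
    exact ⟨(h2.continuousOn.smul h1).intervalIntegrable, (h2.smul continuous_const).intervalIntegrable _ _⟩
  have hbot : ∫ x : ℝ in a..b, g ((x : ℂ) + c * I) =
      (∫ x : ℝ in a..b, ((x : ℂ) + c * I - ρ)⁻¹ • f ((x : ℂ) + c * I)) -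
        (∫ x : ℝ in a..b, ((x : ℂ) + c * I - ρ)⁻¹) • f ρ := by
    obtain ⟨h1, h2⟩ := hside_h c (left_mem_Icc.mpr hcd) hc.ne
    rw [← intervalIntegral.integral_smul_const, ← intervalIntegral.integral_sub h1 h2]
    exact intervalIntegral.integral_congr fun x _ ↦ hgpt _ (hne_h x c hc.ne)
  have htop : ∫ x : ℝ in a..b, g ((x : ℂ) + d * I) =
      (∫ x : ℝ in a..b, ((x : ℂ) + d * I - ρ)⁻¹ • f ((x : ℂ) + d * I)) -
        (∫ x : ℝ in a..b, ((x : ℂ) + d * I - ρ)⁻¹) • f ρ := by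
    obtain ⟨h1, h2⟩ := hside_h d (right_mem_Icc.mpr hcd) hd.ne'
    rw [← intervalIntegral.integral_smul_const, ← intervalIntegral.integral_sub h1 h2]
    exact intervalIntegral.integral_congr fun x _ ↦ hgpt _ (hne_h x d hd.ne')
  have hright : ∫ y : ℝ in c..d, g ((b : ℂ) + y * I) =
      (∫ y : ℝ in c..d, ((b : ℂ) + y * I - ρ)⁻¹ • f ((b : ℂ) + y * I)) -
        (∫ y : ℝ in c..d, ((b : ℂ) + y * I - ρ)⁻¹) • f ρ := by
    obtain ⟨h1, h2⟩ := hside_v b (right_mem_Icc.mpr hab) hb.ne'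
    rw [← intervalIntegral.integral_smul_const, ← intervalIntegral.integral_sub h1 h2]
    exact intervalIntegral.integral_congr fun y _ ↦ hgpt _ (hne_v b y hb.ne')
  have hleft : ∫ y : ℝ in c..d, g ((a : ℂ) + y * I) =
      (∫ y : ℝ in c..d, ((a : ℂ) + y * I - ρ)⁻¹ • f ((a : ℂ) + y * I)) -
        (∫ y : ℝ in c..d, ((a : ℂ) + y * I - ρ)⁻¹) • f ρ := by
    obtain ⟨h1, h2⟩ := hside_v a (left_mem_Icc.mpr hab) ha.ne
    rw [← intervalIntegral.integral_smul_const, ← intervalIntegral.integral_sub h1 h2]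
    exact intervalIntegral.integral_congr fun y _ ↦ hgpt _ (hne_v a y ha.ne)
  rw [hbot, htop, hright, hleft] at hCG
  have hw := integral_boundary_rect_inv_sub ρ ha hb hc hd
  set A₁ := ∫ x : ℝ in a..b, ((x : ℂ) + c * I - ρ)⁻¹ • f ((x : ℂ) + c * I)
  set A₂ := ∫ x : ℝ in a..b, ((x : ℂ) + d * I - ρ)⁻¹ • f ((x : ℂ) + d * I)
  set A₃ := ∫ y : ℝ in c..d, ((b : ℂ) + y * I - ρ)⁻¹ • f ((b : ℂ) + y * I)
  set A₄ := ∫ y : ℝ in c..d, ((a : ℂ) + y * I - ρ)⁻¹ • f ((a : ℂ) + y * I)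
  set c₁ := ∫ x : ℝ in a..b, ((x : ℂ) + c * I - ρ)⁻¹
  set c₂ := ∫ x : ℝ in a..b, ((x : ℂ) + d * I - ρ)⁻¹
  set c₃ := ∫ y : ℝ in c..d, ((b : ℂ) + y * I - ρ)⁻¹
  set c₄ := ∫ y : ℝ in c..d, ((a : ℂ) + y * I - ρ)⁻¹
  calc A₁ - A₂ + I • A₃ - I • A₄
      = (c₁ - c₂ + I * c₃ - I * c₄) • f ρ +
          (A₁ - c₁ • f ρ - (A₂ - c₂ • f ρ) + I • (A₃ - c₃ • f ρ) - I • (A₄ - c₄ • f ρ)) := by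
        simp only [sub_smul, add_smul, mul_smul, smul_sub]
        abel
    _ = (2 * Real.pi * I) • f ρ := by rw [hw, hCG, add_zero]

end Cauchy

/-! ### Riemann sums, uniformly in a compact parameter -/

section Riemann

variable {Y : Type*} [PseudoMetricSpace Y] {F : Type*} [NormedAddCommGroup F] [NormedSpace ℝ F]
  [CompleteSpace F]

/-- Left Riemann sums of a continuous integrand converge to the integral uniformly in a compact
parameter: for `k` continuous on `[α, β] × C`, `C` compact, and `ε > 0` there is `N ≥ 1` with
`‖∫_α^β k(s, y) ds − ∑_{j<N} h • k(α + j h, y)‖ ≤ ε` for all `y ∈ C`, `h = (β − α)/N` (uniform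
continuity on the compact set `[α, β] × C`). [folklore] -/
theorem exists_riemann_sum_approx {k : ℝ → Y → F} {α β : ℝ} (hαβ : α ≤ β) {C : Set Y}
    (hC : IsCompact C) (hk : ContinuousOn (fun q : ℝ × Y => k q.1 q.2) (Icc α β ×ˢ C)) {ε : ℝ}
    (hε : 0 < ε) :
    ∃ N : ℕ, 0 < N ∧ ∀ y ∈ C,
      ‖(∫ s in α..β, k s y) - ∑ j ∈ Finset.range N,
          ((β - α) / N) • k (α + j * ((β - α) / N)) y‖ ≤ ε := by
  -- uniform continuity on the compact set `[α, β] × C`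
  have hKc : IsCompact (Icc α β ×ˢ C) := isCompact_Icc.prod hC
  have huc := hKc.uniformContinuousOn_of_continuous hk
  set ε' : ℝ := ε / (β - α + 1) with hε'
  have hβα : 0 ≤ β - α := sub_nonneg.2 hαβ
  have hε'0 : 0 < ε' := div_pos hε (by linarith)
  obtain ⟨θ, hθ0, hθ⟩ := Metric.uniformContinuousOn_iff_le.1 huc ε' hε'0
  -- number of subdivision points
  obtain ⟨N, hNpos, hNθ⟩ : ∃ N : ℕ, 0 < N ∧ (β - α) / N < θ := by
    refine ⟨⌈(β - α) / θ⌉₊ + 1, Nat.succ_pos _, ?_⟩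
    have h1 : (β - α) / θ < (⌈(β - α) / θ⌉₊ + 1 : ℕ) := by
      push_cast
      exact (Nat.le_ceil _).trans_lt (lt_add_one _)
    have h2 : (0 : ℝ) < (⌈(β - α) / θ⌉₊ + 1 : ℕ) := by positivity
    rw [div_lt_iff₀ h2]
    rw [div_lt_iff₀ hθ0] at h1
    linarith [mul_comm θ ((⌈(β - α) / θ⌉₊ + 1 : ℕ) : ℝ)]
  refine ⟨N, hNpos, fun y hy => ?_⟩
  set h : ℝ := (β - α) / N with hh
  have hN0 : (N : ℝ) ≠ 0 := by exact_mod_cast hNpos.ne'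
  have hh0 : 0 ≤ h := div_nonneg hβα (Nat.cast_nonneg N)
  have hNh : (N : ℝ) * h = β - α := by rw [hh]; field_simp
  -- the nodes
  set s : ℕ → ℝ := fun j => α + j * h with hs
  have hs0 : s 0 = α := by simp [hs]
  have hsN : s N = β := by simp only [hs]; linarith
  have hs_succ : ∀ j, s (j + 1) - s j = h := by intro j; simp only [hs]; push_cast; ring
  have hs_mono : ∀ j, s j ≤ s (j + 1) := fun j => by linarith [hs_succ j]
  have hs_ge : ∀ j, α ≤ s j := fun j => by
    simp only [hs]; nlinarith [Nat.cast_nonneg (α := ℝ) j]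
  have hs_le : ∀ j, j ≤ N → s j ≤ β := fun j hj => by
    simp only [hs]
    have : (j : ℝ) * h ≤ N * h := mul_le_mul_of_nonneg_right (by exact_mod_cast hj) hh0
    linarith
  -- continuity of `k (·) y` on `[α, β]`
  have hky : ContinuousOn (fun t => k t y) (Icc α β) :=
    hk.comp (f := fun t : ℝ => (t, y)) (by fun_prop) fun t ht => ⟨ht, hy⟩
  have hint : ∀ j < N, IntervalIntegrable (fun t => k t y) volume (s j) (s (j + 1)) := by
    intro j hj
    refine (hky.mono ?_).intervalIntegrable
    rw [uIcc_of_le (hs_mono j)]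
    exact Icc_subset_Icc (hs_ge j) (hs_le (j + 1) hj)
  have hsum := intervalIntegral.sum_integral_adjacent_intervals hint
  rw [hs0, hsN] at hsum
  rw [← hsum, ← Finset.sum_sub_distrib]
  -- each piece
  have hpiece : ∀ j ∈ Finset.range N,
      ‖(∫ t in s j..s (j + 1), k t y) - h • k (s j) y‖ ≤ ε' * h := by
    intro j hj
    have hjN : j < N := Finset.mem_range.1 hj
    have hcint : IntervalIntegrable (fun _ : ℝ => k (s j) y) volume (s j) (s (j + 1)) :=
      intervalIntegrable_const
    have heq : (∫ t in s j..s (j + 1), k t y) - h • k (s j) y =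
        ∫ t in s j..s (j + 1), (k t y - k (s j) y) := by
      rw [intervalIntegral.integral_sub (hint j hjN) hcint, intervalIntegral.integral_const, hs_succ]
    rw [heq]
    have hb := intervalIntegral.norm_integral_le_of_norm_le_const (a := s j) (b := s (j + 1))
      (C := ε') (f := fun t => k t y - k (s j) y) ?_
    · rwa [hs_succ, abs_of_nonneg hh0] at hb
    intro t ht
    rw [uIoc_of_le (hs_mono j)] at ht
    have htI : t ∈ Icc α β := ⟨(hs_ge j).trans ht.1.le, ht.2.trans (hs_le (j + 1) hjN)⟩
    have hsjI : s j ∈ Icc α β := ⟨hs_ge j, hs_le j hjN.le⟩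
    have hdist : dist (t, y) (s j, y) ≤ θ := by
      rw [Prod.dist_eq, dist_self, max_eq_left dist_nonneg, Real.dist_eq,
        abs_of_nonneg (sub_nonneg.2 ht.1.le)]
      linarith [ht.2, hs_succ j]
    have := hθ (t, y) ⟨htI, hy⟩ (s j, y) ⟨hsjI, hy⟩ hdist
    rwa [dist_eq_norm] at this
  calc ‖∑ j ∈ Finset.range N, ((∫ t in s j..s (j + 1), k t y) - h • k (s j) y)‖
      ≤ ∑ j ∈ Finset.range N, ε' * h := norm_sum_le_of_le _ hpiece
    _ = ε' * (β - α) := by rw [Finset.sum_const, Finset.card_range, nsmul_eq_mul, ← hNh]; ring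
    _ ≤ ε := by
        rw [hε', div_mul_eq_mul_div, div_le_iff₀ (by linarith)]
        nlinarith

end Riemann

/-! ### The complement of a compact rectangle is connected -/

/-- `ℂ \ ([a,b] × [c,d])` is preconnected: it is the union of four open half-planes, consecutive
ones of which meet. [folklore] -/
theorem isPreconnected_compl_reProdIm (a b c d : ℝ) : IsPreconnected (Icc a b ×ℂ Icc c d)ᶜ := by
  have hset : (Icc a b ×ℂ Icc c d)ᶜ =
      (({z : ℂ | z.re < a} ∪ {z : ℂ | z.im < c}) ∪ {z : ℂ | b < z.re}) ∪ {z : ℂ | d < z.im} := by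
    ext z
    simp only [mem_compl_iff, mem_reProdIm, mem_Icc, not_and_or, not_le, mem_union, mem_setOf_eq]
    tauto
  rw [hset]
  refine IsPreconnected.union ((b + 1 : ℝ) + (d + 1 : ℝ) * I) ?_ ?_
    (IsPreconnected.union ((b + 1 : ℝ) + (c - 1 : ℝ) * I) ?_ ?_
      (IsPreconnected.union ((a - 1 : ℝ) + (c - 1 : ℝ) * I) ?_ ?_
        (convex_halfSpace_re_lt a).isPreconnected (convex_halfSpace_im_lt c).isPreconnected)
      (convex_halfSpace_re_gt b).isPreconnected)
    (convex_halfSpace_im_gt d).isPreconnected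
  · refine Or.inr ?_
    simp
  · simp
  · refine Or.inr ?_
    simp
  · simp
  · simp
  · simp

/-- Runge for the Cauchy kernel: for `ζ` outside the compact rectangle `R`, `z ↦ (ζ − z)⁻¹` is a
uniform limit of polynomials on `R` (one-variable Runge, `ℂ \ R` connected). [folklore] -/
theorem exists_polynomial_approx_inv_sub {a b c d : ℝ} {ζ : ℂ} (hζ : ζ ∉ Icc a b ×ℂ Icc c d)
    {ε : ℝ} (hε : 0 < ε) :
    ∃ t : Polynomial ℂ, ∀ z ∈ Icc a b ×ℂ Icc c d, ‖(ζ - z)⁻¹ - t.eval z‖ < ε := by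
  refine _root_.Complex.exists_polynomial_norm_sub_lt (Ω := {ζ}ᶜ) isOpen_compl_singleton
    (isCompact_Icc.reProdIm isCompact_Icc) (fun z hz h => hζ (mem_singleton_iff.1 h ▸ hz))
    (isPreconnected_compl_reProdIm a b c d) ?_ hε
  exact (differentiableOn_const _ |>.sub differentiableOn_id).inv fun z hz =>
    sub_ne_zero.2 (Ne.symm hz)

/-! ### One side of the boundary: Riemann sum + Runge for the kernels -/

section Side

variable {P : Type*} [NormedAddCommGroup P] [NormedSpace ℂ P]
  {F : Type*} [NormedAddCommGroup F] [NormedSpace ℂ F] [CompleteSpace F]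

omit [NormedSpace ℂ P] in
/-- Approximation of one side integral `∫_α^β (γ(s) − z)⁻¹ • f(γ(s), p) ds` of the Cauchy formula,
uniformly in `(z, p) ∈ R × K'` (`R` a compact rectangle avoided by the side `γ`, `K'` compact), by
finite sums `∑_j t_j(z) • f(γ(σ_j), p)` with polynomials `t_j` and nodes `σ_j ∈ [α, β]` (GR Kap. III
§2, proof of Satz 1: a Riemann sum, then Runge for the kernels `(γ(σ_j) − z)⁻¹`).
[cite: GrauertRemmert1977, Kap. III §2.1 Satz 1 (proof)] -/
theorem exists_sum_approx_side_integral {γ : ℝ → ℂ} (hγ : Continuous γ) {α β : ℝ} (hαβ : α ≤ β)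
    {f : ℂ × P → F} {U : Set (ℂ × P)} (hfc : ContinuousOn f U)
    {a b c d : ℝ} {K' : Set P} (hK' : IsCompact K')
    (hγU : ∀ s ∈ Icc α β, ∀ p ∈ K', (γ s, p) ∈ U)
    (hγR : ∀ s ∈ Icc α β, γ s ∉ Icc a b ×ℂ Icc c d) {ε : ℝ} (hε : 0 < ε) :
    ∃ (N : ℕ) (t : ℕ → Polynomial ℂ) (σ : ℕ → ℝ), (∀ j, σ j ∈ Icc α β) ∧
      ∀ z ∈ Icc a b ×ℂ Icc c d, ∀ p ∈ K',
        ‖(∫ s in α..β, (γ s - z)⁻¹ • f (γ s, p)) -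
            ∑ j ∈ Finset.range N, (t j).eval z • f (γ (σ j), p)‖ ≤ ε := by
  set R : Set ℂ := Icc a b ×ℂ Icc c d with hRdef
  have hRc : IsCompact R := isCompact_Icc.reProdIm isCompact_Icc
  -- the integrand and its continuity on `[α, β] × (R × K')`
  set k : ℝ → ℂ × P → F := fun s w => (γ s - w.1)⁻¹ • f (γ s, w.2) with hk
  have hkc : ContinuousOn (fun q : ℝ × (ℂ × P) => k q.1 q.2) (Icc α β ×ˢ (R ×ˢ K')) := by
    simp only [hk]
    refine ContinuousOn.smul ?_ ?_
    · refine ContinuousOn.inv₀ (by fun_prop) ?_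
      rintro ⟨s, z, p⟩ ⟨hs, hz, -⟩ h0
      exact hγR s hs (by rwa [sub_eq_zero.1 h0])
    · refine hfc.comp (by fun_prop) ?_
      rintro ⟨s, z, p⟩ ⟨hs, -, hp⟩
      exact hγU s hs p hp
  have hε2 : 0 < ε / 2 := by positivity
  obtain ⟨N, hN, hRS⟩ := exists_riemann_sum_approx (F := F) hαβ (hRc.prod hK') hkc hε2
  set h : ℝ := (β - α) / N with hh
  have hh0 : 0 ≤ h := div_nonneg (sub_nonneg.2 hαβ) (Nat.cast_nonneg N)
  have hNh : (N : ℝ) * h = β - α := by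
    rw [hh]; field_simp [(show (N : ℝ) ≠ 0 by exact_mod_cast hN.ne')]
  -- the nodes (clamped to `[α, β]`, which changes nothing for `j < N`)
  set σ : ℕ → ℝ := fun j => min (α + j * h) β with hσ
  have hσmem : ∀ j, σ j ∈ Icc α β := fun j =>
    ⟨le_min (by nlinarith [Nat.cast_nonneg (α := ℝ) j]) hαβ, min_le_right _ _⟩
  have hσeq : ∀ j < N, σ j = α + j * h := by
    intro j hj
    refine min_eq_left ?_
    have : (j : ℝ) * h ≤ N * h := mul_le_mul_of_nonneg_right (by exact_mod_cast hj.le) hh0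
    linarith
  -- a bound for `f` on the compact set `γ([α, β]) × K'`
  obtain ⟨M, hM0, hM⟩ : ∃ M : ℝ, 0 ≤ M ∧ ∀ s ∈ Icc α β, ∀ p ∈ K', ‖f (γ s, p)‖ ≤ M := by
    have hcpt : IsCompact ((γ '' Icc α β) ×ˢ K') := (isCompact_Icc.image hγ).prod hK'
    obtain ⟨M, hM⟩ := hcpt.exists_bound_of_continuousOn (f := f)
      (hfc.mono (by rintro ⟨w, p⟩ ⟨⟨s, hs, rfl⟩, hp⟩; exact hγU s hs p hp))
    exact ⟨max M 0, le_max_right _ _,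
      fun s hs p hp => (hM _ ⟨⟨s, hs, rfl⟩, hp⟩).trans (le_max_left _ _)⟩
  -- Runge for the kernels
  set ε₂ : ℝ := ε / (2 * ((β - α) * M + 1)) with hε₂
  have hden : 0 < (β - α) * M + 1 := by nlinarith [sub_nonneg.2 hαβ]
  have hε₂0 : 0 < ε₂ := by positivity
  have hker : ∀ j, ∃ t : Polynomial ℂ, ∀ z ∈ R, ‖(γ (σ j) - z)⁻¹ - t.eval z‖ < ε₂ := fun j =>
    exists_polynomial_approx_inv_sub (hγR (σ j) (hσmem j)) hε₂0
  choose t' ht' using hker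
  refine ⟨N, fun j => Polynomial.C (h : ℂ) * t' j, σ, hσmem, fun z hz p hp => ?_⟩
  have hRS' := hRS (z, p) ⟨hz, hp⟩
  simp only [hk] at hRS'
  -- compare the Riemann sum with the polynomial sum
  have hdiff : ‖∑ j ∈ Finset.range N, h • ((γ (α + j * h) - z)⁻¹ • f (γ (α + j * h), p)) -
      ∑ j ∈ Finset.range N, (Polynomial.C (h : ℂ) * t' j).eval z • f (γ (σ j), p)‖ ≤ ε / 2 := by
    rw [← Finset.sum_sub_distrib]
    have hterm : ∀ j ∈ Finset.range N,
        ‖h • ((γ (α + j * h) - z)⁻¹ • f (γ (α + j * h), p)) -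
          (Polynomial.C (h : ℂ) * t' j).eval z • f (γ (σ j), p)‖ ≤ h * ε₂ * M := by
      intro j hj
      have hjN := Finset.mem_range.1 hj
      rw [← hσeq j hjN, Polynomial.eval_mul, Polynomial.eval_C, ← smul_assoc, ← sub_smul]
      refine (norm_smul_le _ _).trans ?_
      have h1 : ‖(h : ℂ) • (γ (σ j) - z)⁻¹ - (h : ℂ) * (t' j).eval z‖ ≤ h * ε₂ := by
        rw [smul_eq_mul, ← mul_sub, norm_mul, Complex.norm_real, Real.norm_of_nonneg hh0]
        exact mul_le_mul_of_nonneg_left (ht' j z hz).le hh0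
      exact mul_le_mul h1 (hM _ (hσmem j) p hp) (norm_nonneg _) (by positivity)
    refine (norm_sum_le_of_le _ hterm).trans ?_
    rw [Finset.sum_const, Finset.card_range, nsmul_eq_mul,
      show (N : ℝ) * (h * ε₂ * M) = (N * h) * M * ε₂ by ring, hNh, hε₂]
    rw [mul_div_assoc', div_le_div_iff₀ (by positivity) two_pos]
    nlinarith [sub_nonneg.2 hαβ]
  have hreal : ∀ j ∈ Finset.range N,
      h • ((γ (α + j * h) - z)⁻¹ • f (γ (α + j * h), p)) =
        ((β - α) / N) • ((γ (α + j * ((β - α) / N)) - z)⁻¹ • f (γ (α + j * ((β - α) / N)), p)) :=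
    fun j _ => rfl
  calc ‖(∫ s in α..β, (γ s - z)⁻¹ • f (γ s, p)) -
          ∑ j ∈ Finset.range N, (Polynomial.C (h : ℂ) * t' j).eval z • f (γ (σ j), p)‖
      = ‖((∫ s in α..β, (γ s - z)⁻¹ • f (γ s, p)) -
            ∑ j ∈ Finset.range N, h • ((γ (α + j * h) - z)⁻¹ • f (γ (α + j * h), p))) +
          (∑ j ∈ Finset.range N, h • ((γ (α + j * h) - z)⁻¹ • f (γ (α + j * h), p)) -
            ∑ j ∈ Finset.range N, (Polynomial.C (h : ℂ) * t' j).eval z • f (γ (σ j), p))‖ := by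
        rw [sub_add_sub_cancel]
    _ ≤ ε / 2 + ε / 2 := norm_add_le_of_le hRS' hdiff
    _ = ε := by ring

end Side

/-! ### Runge's theorem with parameters (GR Kap. III §2 Satz 1) -/

section Runge

variable {P : Type*} [NormedAddCommGroup P] [NormedSpace ℂ P]
  {F : Type*} [NormedAddCommGroup F] [NormedSpace ℂ F] [CompleteSpace F]

/-- **Runge's approximation theorem with parameters on a rectangle** (Grauert–Remmert, Kap. III
§2.1 Satz 1). Let `R = [a, b] × [c, d]`, `η > 0`, `Q = [a − η, b + η] × [c − η, d + η]`, `K'` a compact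
parameter set and `f` holomorphic (jointly, Banach-space-valued) on an open set `U ⊇ Q × K'`. Then for
every `δ > 0` there are finitely many points `ζ_i ∈ Q` and polynomials `t_i ∈ ℂ[z]` such that
`‖f(z, p) − ∑_i t_i(z) • f(ζ_i, p)‖ ≤ δ` for all `z ∈ R`, `p ∈ K'` — an approximation by a
polynomial in `z` whose coefficients `f(ζ_i, ·)` are holomorphic in the parameter wherever `f` is.
[cite: GrauertRemmert1977, Kap. III §2.1 Satz 1] -/
theorem runge_rectangle_param {f : ℂ × P → F} {U : Set (ℂ × P)}
    (hf : DifferentiableOn ℂ f U) {a b c d η : ℝ} (hab : a ≤ b) (hcd : c ≤ d) (hη : 0 < η)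
    {K' : Set P} (hK' : IsCompact K')
    (hsub : (Icc (a - η) (b + η) ×ℂ Icc (c - η) (d + η)) ×ˢ K' ⊆ U) {δ : ℝ} (hδ : 0 < δ) :
    ∃ (ι : Type) (_ : Fintype ι) (ζ : ι → ℂ) (t : ι → Polynomial ℂ),
      (∀ i, ζ i ∈ Icc (a - η) (b + η) ×ℂ Icc (c - η) (d + η)) ∧
      ∀ z ∈ Icc a b ×ℂ Icc c d, ∀ p ∈ K',
        ‖f (z, p) - ∑ i, (t i).eval z • f (ζ i, p)‖ ≤ δ := by
  set a₁ : ℝ := a - η with ha₁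
  set b₁ : ℝ := b + η with hb₁
  set c₁ : ℝ := c - η with hc₁
  set d₁ : ℝ := d + η with hd₁
  have hab₁ : a₁ ≤ b₁ := by linarith
  have hcd₁ : c₁ ≤ d₁ := by linarith
  have hfc : ContinuousOn f U := hf.continuousOn
  -- the four sides of `∂Q`
  set γ₁ : ℝ → ℂ := fun s => (s : ℂ) + c₁ * I with hγ₁
  set γ₂ : ℝ → ℂ := fun s => (s : ℂ) + d₁ * I with hγ₂
  set γ₃ : ℝ → ℂ := fun s => (b₁ : ℂ) + s * I with hγ₃
  set γ₄ : ℝ → ℂ := fun s => (a₁ : ℂ) + s * I with hγ₄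
  have hQ : ∀ (x y : ℝ), x ∈ Icc a₁ b₁ → y ∈ Icc c₁ d₁ → ∀ p ∈ K', ((x : ℂ) + y * I, p) ∈ U := by
    intro x y hx hy p hp
    refine hsub ⟨⟨?_, ?_⟩, hp⟩
    · simpa using hx
    · simpa using hy
  have hγU₁ : ∀ s ∈ Icc a₁ b₁, ∀ p ∈ K', (γ₁ s, p) ∈ U :=
    fun s hs p hp => hQ s c₁ hs (left_mem_Icc.2 hcd₁) p hp
  have hγU₂ : ∀ s ∈ Icc a₁ b₁, ∀ p ∈ K', (γ₂ s, p) ∈ U :=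
    fun s hs p hp => hQ s d₁ hs (right_mem_Icc.2 hcd₁) p hp
  have hγU₃ : ∀ s ∈ Icc c₁ d₁, ∀ p ∈ K', (γ₃ s, p) ∈ U :=
    fun s hs p hp => hQ b₁ s (right_mem_Icc.2 hab₁) hs p hp
  have hγU₄ : ∀ s ∈ Icc c₁ d₁, ∀ p ∈ K', (γ₄ s, p) ∈ U :=
    fun s hs p hp => hQ a₁ s (left_mem_Icc.2 hab₁) hs p hp
  have hγR₁ : ∀ s ∈ Icc a₁ b₁, γ₁ s ∉ Icc a b ×ℂ Icc c d := by
    intro s _ h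
    have := h.2.1
    simp [hγ₁] at this
    linarith
  have hγR₂ : ∀ s ∈ Icc a₁ b₁, γ₂ s ∉ Icc a b ×ℂ Icc c d := by
    intro s _ h
    have := h.2.2
    simp [hγ₂] at this
    linarith
  have hγR₃ : ∀ s ∈ Icc c₁ d₁, γ₃ s ∉ Icc a b ×ℂ Icc c d := by
    intro s _ h
    have := h.1.2
    simp [hγ₃] at this
    linarith
  have hγR₄ : ∀ s ∈ Icc c₁ d₁, γ₄ s ∉ Icc a b ×ℂ Icc c d := by
    intro s _ h
    have := h.1.1
    simp [hγ₄] at this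
    linarith
  obtain ⟨N₁, t₁, σ₁, hσ₁, h₁⟩ := exists_sum_approx_side_integral (γ := γ₁) (by fun_prop) hab₁ hfc
    hK' hγU₁ hγR₁ hδ
  obtain ⟨N₂, t₂, σ₂, hσ₂, h₂⟩ := exists_sum_approx_side_integral (γ := γ₂) (by fun_prop) hab₁ hfc
    hK' hγU₂ hγR₂ hδ
  obtain ⟨N₃, t₃, σ₃, hσ₃, h₃⟩ := exists_sum_approx_side_integral (γ := γ₃) (by fun_prop) hcd₁ hfc
    hK' hγU₃ hγR₃ hδ
  obtain ⟨N₄, t₄, σ₄, hσ₄, h₄⟩ := exists_sum_approx_side_integral (γ := γ₄) (by fun_prop) hcd₁ hfc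
    hK' hγU₄ hγR₄ hδ
  -- assemble
  set κ : ℂ := (2 * Real.pi * I)⁻¹ with hκ
  have h2πI : (2 * Real.pi * I : ℂ) ≠ 0 := by
    simp [Real.pi_ne_zero, I_ne_zero]
  let ζ : (Fin N₁ ⊕ Fin N₂) ⊕ (Fin N₃ ⊕ Fin N₄) → ℂ :=
    Sum.elim (Sum.elim (fun j => γ₁ (σ₁ j)) (fun j => γ₂ (σ₂ j)))
      (Sum.elim (fun j => γ₃ (σ₃ j)) (fun j => γ₄ (σ₄ j)))
  let t : (Fin N₁ ⊕ Fin N₂) ⊕ (Fin N₃ ⊕ Fin N₄) → Polynomial ℂ :=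
    Sum.elim (Sum.elim (fun j => Polynomial.C κ * t₁ j) (fun j => Polynomial.C (-κ) * t₂ j))
      (Sum.elim (fun j => Polynomial.C (κ * I) * t₃ j) (fun j => Polynomial.C (-(κ * I)) * t₄ j))
  refine ⟨(Fin N₁ ⊕ Fin N₂) ⊕ (Fin N₃ ⊕ Fin N₄), inferInstance, ζ, t, ?_, ?_⟩
  · -- the nodes lie on `∂Q ⊆ Q`
    rintro ((j | j) | (j | j))
    · exact ⟨by simpa [ζ, hγ₁] using hσ₁ j, by simpa [ζ, hγ₁] using left_mem_Icc.2 hcd₁⟩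
    · exact ⟨by simpa [ζ, hγ₂] using hσ₂ j, by simpa [ζ, hγ₂] using right_mem_Icc.2 hcd₁⟩
    · exact ⟨by simpa [ζ, hγ₃] using right_mem_Icc.2 hab₁, by simpa [ζ, hγ₃] using hσ₃ j⟩
    · exact ⟨by simpa [ζ, hγ₄] using left_mem_Icc.2 hab₁, by simpa [ζ, hγ₄] using hσ₄ j⟩
  intro z hz p hp
  -- Cauchy's formula for the slice `f(·, p)` on `Q`
  have hslice : DifferentiableOn ℂ (fun w : ℂ => f (w, p)) (Icc a₁ b₁ ×ℂ Icc c₁ d₁) := by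
    refine hf.comp (by fun_prop) ?_
    intro w hw
    have := hQ w.re w.im hw.1 hw.2 p hp
    simpa using this
  have hza : a₁ < z.re := by have := hz.1.1; simp only [ha₁]; linarith
  have hzb : z.re < b₁ := by have := hz.1.2; simp only [hb₁]; linarith
  have hzc : c₁ < z.im := by have := hz.2.1; simp only [hc₁]; linarith
  have hzd : z.im < d₁ := by have := hz.2.2; simp only [hd₁]; linarith
  have hC := integral_boundary_rect_inv_sub_smul_eq (f := fun w : ℂ => f (w, p)) z hza hzb hzc hzd
    hslice
  set A₁ := ∫ s in a₁..b₁, (γ₁ s - z)⁻¹ • f (γ₁ s, p) with hA₁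
  set A₂ := ∫ s in a₁..b₁, (γ₂ s - z)⁻¹ • f (γ₂ s, p) with hA₂
  set A₃ := ∫ s in c₁..d₁, (γ₃ s - z)⁻¹ • f (γ₃ s, p) with hA₃
  set A₄ := ∫ s in c₁..d₁, (γ₄ s - z)⁻¹ • f (γ₄ s, p) with hA₄
  change A₁ - A₂ + I • A₃ - I • A₄ = (2 * Real.pi * I) • f (z, p) at hC
  set S₁ := ∑ j ∈ Finset.range N₁, (t₁ j).eval z • f (γ₁ (σ₁ j), p) with hS₁
  set S₂ := ∑ j ∈ Finset.range N₂, (t₂ j).eval z • f (γ₂ (σ₂ j), p) with hS₂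
  set S₃ := ∑ j ∈ Finset.range N₃, (t₃ j).eval z • f (γ₃ (σ₃ j), p) with hS₃
  set S₄ := ∑ j ∈ Finset.range N₄, (t₄ j).eval z • f (γ₄ (σ₄ j), p) with hS₄
  have hfz : f (z, p) = κ • (A₁ - A₂ + I • A₃ - I • A₄) := by
    rw [hC, smul_smul, hκ, inv_mul_cancel₀ h2πI, one_smul]
  have hsum : ∑ i, (t i).eval z • f (ζ i, p) = κ • (S₁ - S₂ + I • S₃ - I • S₄) := by
    simp only [Fintype.sum_sum_type, ζ, t, Sum.elim_inl, Sum.elim_inr, Polynomial.eval_mul,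
      Polynomial.eval_C, mul_smul, ← Finset.smul_sum]
    rw [Fin.sum_univ_eq_sum_range (fun j => (t₁ j).eval z • f (γ₁ (σ₁ j), p)) N₁,
      Fin.sum_univ_eq_sum_range (fun j => (t₂ j).eval z • f (γ₂ (σ₂ j), p)) N₂,
      Fin.sum_univ_eq_sum_range (fun j => (t₃ j).eval z • f (γ₃ (σ₃ j), p)) N₃,
      Fin.sum_univ_eq_sum_range (fun j => (t₄ j).eval z • f (γ₄ (σ₄ j), p)) N₄]
    simp only [smul_sub, smul_add, neg_smul, mul_smul, ← hS₁, ← hS₂, ← hS₃, ← hS₄]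
    abel
  have hκnorm : ‖κ‖ = (2 * Real.pi)⁻¹ := by
    simp [hκ, Complex.norm_real, abs_of_pos Real.pi_pos]
  rw [hfz, hsum, ← smul_sub]
  have hinner : A₁ - A₂ + I • A₃ - I • A₄ - (S₁ - S₂ + I • S₃ - I • S₄) =
      (A₁ - S₁) - (A₂ - S₂) + I • (A₃ - S₃) - I • (A₄ - S₄) := by
    simp only [smul_sub]; abel
  rw [hinner, norm_smul, hκnorm]
  have e₁ := h₁ z hz p hp
  have e₂ := h₂ z hz p hp
  have e₃ := h₃ z hz p hp
  have e₄ := h₄ z hz p hp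
  rw [← hA₁, ← hS₁] at e₁
  rw [← hA₂, ← hS₂] at e₂
  rw [← hA₃, ← hS₃] at e₃
  rw [← hA₄, ← hS₄] at e₄
  have hI : ∀ v : F, ‖I • v‖ = ‖v‖ := fun v => by rw [norm_smul, Complex.norm_I, one_mul]
  have htot : ‖(A₁ - S₁) - (A₂ - S₂) + I • (A₃ - S₃) - I • (A₄ - S₄)‖ ≤ 4 * δ := by
    calc ‖(A₁ - S₁) - (A₂ - S₂) + I • (A₃ - S₃) - I • (A₄ - S₄)‖
        ≤ ‖A₁ - S₁‖ + ‖A₂ - S₂‖ + ‖I • (A₃ - S₃)‖ + ‖I • (A₄ - S₄)‖ := by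
          refine (norm_sub_le _ _).trans ?_
          gcongr
          refine (norm_add_le _ _).trans ?_
          gcongr
          exact norm_sub_le _ _
      _ ≤ δ + δ + δ + δ := by rw [hI, hI]; gcongr
      _ = 4 * δ := by ring
  calc (2 * Real.pi)⁻¹ * ‖(A₁ - S₁) - (A₂ - S₂) + I • (A₃ - S₃) - I • (A₄ - S₄)‖
      ≤ (2 * Real.pi)⁻¹ * (4 * δ) := by gcongr
    _ ≤ δ := by
        rw [inv_mul_le_iff₀ (by positivity)]
        nlinarith [Real.two_le_pi]

/-- **Runge with parameters, packaged**: under the hypotheses of `runge_rectangle_param` there is a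
map `g`, holomorphic on `ℂ × V` for an open `V ⊇ K'`, with `‖f − g‖ ≤ δ` on `R × K'`
(`g(z, p) = ∑ t_i(z) • f(ζ_i, p)`). [cite: GrauertRemmert1977, Kap. III §2.1 Satz 1] -/
theorem exists_holomorphic_approx_rectangle_param {f : ℂ × P → F} {U : Set (ℂ × P)}
    (hU : IsOpen U) (hf : DifferentiableOn ℂ f U) {a b c d η : ℝ} (hab : a ≤ b) (hcd : c ≤ d)
    (hη : 0 < η) {K' : Set P} (hK' : IsCompact K')
    (hsub : (Icc (a - η) (b + η) ×ℂ Icc (c - η) (d + η)) ×ˢ K' ⊆ U) {δ : ℝ} (hδ : 0 < δ) :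
    ∃ (g : ℂ × P → F) (V : Set P), IsOpen V ∧ K' ⊆ V ∧ DifferentiableOn ℂ g (univ ×ˢ V) ∧
      ∀ z ∈ Icc a b ×ℂ Icc c d, ∀ p ∈ K', ‖f (z, p) - g (z, p)‖ ≤ δ := by
  obtain ⟨ι, _, ζ, t, hζ, happrox⟩ := runge_rectangle_param hf hab hcd hη hK' hsub hδ
  -- the parameter neighbourhood on which all `f(ζ_i, ·)` are holomorphic
  set V : Set P := {p | ∀ i, (ζ i, p) ∈ U} with hV
  have hVopen : IsOpen V := by
    simp only [hV, setOf_forall]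
    exact isOpen_iInter_of_finite fun i => hU.preimage (by fun_prop)
  have hKV : K' ⊆ V := fun p hp i => hsub ⟨hζ i, hp⟩
  refine ⟨fun w => ∑ i, (t i).eval w.1 • f (ζ i, w.2), V, hVopen, hKV, ?_, fun z hz p hp =>
    happrox z hz p hp⟩
  refine DifferentiableOn.fun_sum fun i _ => ?_
  refine DifferentiableOn.smul ?_ ?_
  · exact ((t i).differentiable.comp differentiable_fst).differentiableOn
  · refine hf.comp (by fun_prop) ?_
    rintro ⟨w, p⟩ ⟨-, hp⟩
    exact hp i

end Runge

end Literature.Analysis.Complex
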